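import Summits.Ventures.QEC.Census.CSSNormalFormSAT.CubeRefute
import Summits.Ventures.QEC.Census.CSSNormalFormSAT.CoverB8W8
import Summits.Ventures.QEC.Census.CSSNormalFormSAT.CoverB9W6
import HarnessLib

/-!
# No Boolean `k = 1` normal form at `(16,5)` for the splits `(b,w) ∈ {(8,8), (9,6)}` (KERNEL-PLAN item 5, cube-covered cases, part A)

As in `NoNormalFormWhole.lean`, but through the cube covers `CoverB8W8` / `CoverB9W6` and `false_of_cubeCover`. (Parts for `(8,7)`, `(8,6)`,
`(9,5)`, `(8,5)` follow when their leaf files are all in the tree.) Theorems only; axioms standard. [folklore]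
-/

set_option autoImplicit false

namespace Summit.Ventures.QEC.Census.CSSNormalFormSAT

/-- No Boolean normal form for `(b,w) = (8,8)`. [folklore] -/
theorem noNF_16_5_b8_w8 (P : ℕ → ℕ → Bool) (hZ : ZCond ⟨16, 5, 8, 8⟩ P) (hX : XCond ⟨16, 5, 8, 8⟩ P)
    (hL : LexCond ⟨16, 5, 8, 8⟩ P) : False :=
  false_of_cubeCover ⟨16, 5, 8, 8⟩ P (by decide) (by decide) hZ hX hL treeB8W8 treeB8W8_wf unsat_nf16_b8_w8_of_leaf

/-- No Boolean normal form for `(b,w) = (9,6)`. [folklore] -/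
theorem noNF_16_5_b9_w6 (P : ℕ → ℕ → Bool) (hZ : ZCond ⟨16, 5, 9, 6⟩ P) (hX : XCond ⟨16, 5, 9, 6⟩ P)
    (hL : LexCond ⟨16, 5, 9, 6⟩ P) : False :=
  false_of_cubeCover ⟨16, 5, 9, 6⟩ P (by decide) (by decide) hZ hX hL treeB9W6 treeB9W6_wf unsat_nf16_b9_w6_of_leaf

end Summit.Ventures.QEC.Census.CSSNormalFormSAT
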